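import Summits.Ventures.PercRepro.Night2TwoOneLossless
import Summits.Ventures.PercRepro.Night2LocalRuleComp
import Summits.Ventures.PercRepro.Night2FatBudget

/-!
# PercRepro — the cell `(2, 1)` with two fat closures: a lossy big covering set has two fat faces (night-2, gen 28)

Two-fat-closure clause of the `(2, 1)` nested residue in its SPREAD regime: every thin member misses `2` or `≥ 7`
points (`hsp`) and there are at most two fat closures (`H₀ = cl B₀`, `H₁ = cl B₁`).  A big thin member `B′`
(`|B′ ∖ K| ≥ 5`) loses at its covering set `Q = B′ ∪ {z}` only if `L1 Q > capS Q ≥ 11/18`; `Q ∖ K` has rank `5` and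
`≥ 6` points, so at most three coloops and at most three thin covering preimages (faces at those coloops), each
requesting `7/24` (fat, `m = 2`) or `≤ 7/54` (`m ≥ 7`).  Two fat faces are needed (`7/24 + 2 · 7/54 < 11/18`), at
most two exist (two fat faces with the same closure `H` put `Q` inside `H`, rank `5 < 6`), and their closures are
`H₀` and `H₁`; the third face is not fat, so `L1 Q ≤ 7/12 + 7/54 = 77/108` and the total loss at `Q` is at most
`77/108 − 11/18 = 11/108`.

* `mem_coloops_erase_of_mem_coloops`, `rkN_sdiff_add_card_of_subset_coloops`, **`card_coloops_le_three`**: a rank-`5`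
  set with `≥ 6` points of a simple matroid has at most three coloops;
* `req_cases_of_thin_sp`: the requests of the spread regime; `clF_eq_or_eq_of_fat`: the two fat closures are all;
* **`two_fat_faces_of_loss_ne_zero`**: the structure of a lossy big covering set;
* **`faceLossP_sum_le_two_one`**: the big-face losses of any set sum to at most `11/108`.
-/

namespace PercRepro.Shadow

open Finset PerFlat ThmH

variable {α : Type*} [DecidableEq α] {M : Matroid α} [M.Finite]

section Coloops

/-- Erasing a point keeps the other coloops. -/
theorem mem_coloops_erase_of_mem_coloops {Y : Finset α} {t w : α} (hw : w ∈ coloops M Y) (hwt : w ≠ t) :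
    w ∈ coloops M (Y.erase t) := by
  rw [mem_coloops] at hw ⊢
  refine ⟨Finset.mem_erase.2 ⟨hwt, hw.1⟩, fun h => hw.2 ?_⟩
  exact clF_mono (Finset.erase_subset_erase w (Finset.erase_subset t Y)) h

/-- `rk (Y ∖ T) + |T| = rk Y` for a set `T` of coloops of `Y`. -/
theorem rkN_sdiff_add_card_of_subset_coloops {Y : Finset α} (hY : Y ⊆ gr M) {T : Finset α}
    (hT : T ⊆ coloops M Y) : rkN M (Y \ T) + T.card = rkN M Y := by
  induction T using Finset.induction_on with
  | empty => simp
  | insert t T htT ih =>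
    have ht : t ∈ coloops M Y := hT (Finset.mem_insert_self _ _)
    have hT' : T ⊆ coloops M Y := (Finset.subset_insert _ _).trans hT
    have h1 : Y \ insert t T = (Y \ T).erase t := by
      ext a
      simp only [Finset.mem_sdiff, Finset.mem_erase, Finset.mem_insert, not_or]
      tauto
    have ht' : t ∈ coloops M (Y \ T) := by
      rw [mem_coloops] at ht ⊢
      refine ⟨Finset.mem_sdiff.2 ⟨ht.1, htT⟩, fun h => ht.2 ?_⟩
      exact clF_mono (Finset.erase_subset_erase t Finset.sdiff_subset) h
    have h2 := rkN_erase_of_mem_coloops (M := M) (Finset.sdiff_subset.trans hY) ht'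
    rw [Finset.card_insert_of_notMem htT, h1]
    have := ih hT'
    omega

/-- **A rank-`5` set with at least six points of a simple loopless matroid has at most three coloops.** -/
theorem card_coloops_le_three (hs : ∀ e ∈ gr M, ∀ f ∈ gr M, e ≠ f → rkN M {e, f} = 2)
    (hl : ∀ e ∈ gr M, M.Indep {e}) {Y : Finset α} (hY : Y ⊆ gr M) (hr : rkN M Y = 5) (h6 : 6 ≤ Y.card) :
    (coloops M Y).card ≤ 3 := by
  have hC : coloops M Y ⊆ Y := fun w hw => (mem_coloops.1 hw).1
  have h := rkN_sdiff_add_card_of_subset_coloops hY (Finset.Subset.refl (coloops M Y))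
  rw [hr] at h
  have hcard : (Y \ coloops M Y).card + (coloops M Y).card = Y.card := Finset.card_sdiff_add_card_eq_card hC
  by_contra hcon
  push Not at hcon
  rcases Nat.lt_or_ge (coloops M Y).card 5 with h4 | h5
  · -- four coloops: the rest has rank `1` and two points
    have hr1 : rkN M (Y \ coloops M Y) = 1 := by omega
    obtain ⟨e, he, f, hf, hef⟩ := Finset.one_lt_card.1 (by omega : 1 < (Y \ coloops M Y).card)
    have hsub : ({e, f} : Finset α) ⊆ Y \ coloops M Y := by
      intro a ha
      rw [Finset.mem_insert, Finset.mem_singleton] at ha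
      rcases ha with rfl | rfl
      · exact he
      · exact hf
    have := rkN_mono (M := M) hsub
    rw [hs e (hY (Finset.mem_sdiff.1 he).1) f (hY (Finset.mem_sdiff.1 hf).1) hef, hr1] at this
    omega
  · -- five coloops: the rest has rank `0` and a point
    have hr0 : rkN M (Y \ coloops M Y) = 0 := by omega
    obtain ⟨e, he⟩ := Finset.card_pos.1 (by omega : 0 < (Y \ coloops M Y).card)
    have h1 := rkN_mono (M := M) (Finset.singleton_subset_iff.2 he)
    have h2 : rkN M ({e} : Finset α) = 1 := by
      rw [rkN_eq_card_of_indep (by rw [Finset.coe_singleton]; exact hl e (hY (Finset.mem_sdiff.1 he).1)),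
        Finset.card_singleton]
    omega

end Coloops

section FatFaces

variable {G : Finset α}

/-- In the spread regime a thin member requests `7/24` (fat, `m = 2`) or at most `7/54` (`m ≥ 7`). -/
theorem req_cases_of_thin_sp (hG : G ∈ flatsQ M (5 + 1)) (hd : (gr M \ G).card = 2)
    (hsp : ∀ B ∈ thinMembers M 5 G, 2 < (G \ clF M B).card → 7 ≤ (G \ clF M B).card) {B : Finset α}
    (hB : B ∈ thinMembers M 5 G) :
    ((G \ clF M B).card = 2 ∧ req M 5 B = 7 / 24) ∨ (7 ≤ (G \ clF M B).card ∧ req M 5 B ≤ 7 / 54) := by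
  have hd' : (gr M \ G).card ≤ 5 := by omega
  have hm2 : 2 ≤ (G \ clF M B).card :=
    two_le_card_sdiff_of_not_lay0 hG hd' (mem_thinMembers.1 hB).1 (mem_thinMembers.1 hB).2
  rw [req_eq_of_thin hG hB, hd]
  unfold phiQ
  push_cast
  by_cases h2 : (G \ clF M B).card = 2
  · left
    refine ⟨h2, ?_⟩
    rw [h2]; norm_num
  · right
    have h7 : 7 ≤ (G \ clF M B).card := hsp B hB (by omega)
    refine ⟨h7, ?_⟩
    have h7' : (7 : ℚ) ≤ ((G \ clF M B).card : ℚ) := by exact_mod_cast h7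
    rw [div_le_div_iff₀ (by linarith) (by norm_num)]
    linarith

/-- With at most two fat closures, the closure of every fat thin member is `H₀` or `H₁`. -/
theorem clF_eq_or_eq_of_fat {B₀ B₁ : Finset α} (hB₀ : B₀ ∈ thinMembers M 5 G) (hB₁ : B₁ ∈ thinMembers M 5 G)
    (hm₀ : (G \ clF M B₀).card ≤ 2) (hm₁ : (G \ clF M B₁).card ≤ 2) (hne : clF M B₀ ≠ clF M B₁)
    (hfat : (fatClosures M 5 G 2).card ≤ 2) {F : Finset α} (hF : F ∈ thinMembers M 5 G)
    (hmF : (G \ clF M F).card ≤ 2) : clF M F = clF M B₀ ∨ clF M F = clF M B₁ := by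
  classical
  have hmem : ∀ {B : Finset α}, B ∈ thinMembers M 5 G → (G \ clF M B).card ≤ 2 →
      clF M B ∈ fatClosures M 5 G 2 := by
    intro B hB hm
    unfold fatClosures
    exact Finset.mem_image_of_mem _ (Finset.mem_filter.2 ⟨hB, hm⟩)
  by_contra hcon
  push Not at hcon
  have hsub : ({clF M B₀, clF M B₁, clF M F} : Finset (Finset α)) ⊆ fatClosures M 5 G 2 := by
    intro H hH
    simp only [Finset.mem_insert, Finset.mem_singleton] at hH
    rcases hH with rfl | rfl | rfl
    · exact hmem hB₀ hm₀
    · exact hmem hB₁ hm₁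
    · exact hmem hF hmF
  have h3 : ({clF M B₀, clF M B₁, clF M F} : Finset (Finset α)).card = 3 := by
    rw [Finset.card_insert_of_notMem, Finset.card_pair (Ne.symm hcon.2)]
    simp only [Finset.mem_insert, Finset.mem_singleton, not_or]
    exact ⟨hne, Ne.symm hcon.1⟩
  have := Finset.card_le_card hsub
  omega

open scoped Classical in
/-- **A LOSSY BIG COVERING SET HAS TWO FAT FACES** (cell `(2, 1)`, spread regime, two fat closures `H₀ ≠ H₁`): for a
big thin member `B` and `z ∈ G ∖ cl B` with `loss B z ≠ 0`, the covering set `Q = B ∪ {z}` has `L1 Q ≤ 77/108` and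
two distinct faces `Q ∖ u`, `Q ∖ u′` that are thin members with closures `H₀`, `H₁`. -/
theorem two_fat_faces_of_loss_ne_zero (hG : G ∈ flatsQ M (5 + 1)) (hd : (gr M \ G).card = 2)
    (hk : kColoops M G = 1) (hs : ∀ e ∈ gr M, ∀ f ∈ gr M, e ≠ f → rkN M {e, f} = 2)
    (hl : ∀ e ∈ gr M, M.Indep {e}) {B₀ B₁ : Finset α} (hB₀ : B₀ ∈ thinMembers M 5 G)
    (hB₁ : B₁ ∈ thinMembers M 5 G) (hm₀ : (G \ clF M B₀).card ≤ 2) (hm₁ : (G \ clF M B₁).card ≤ 2)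
    (hne : clF M B₀ ≠ clF M B₁) (hfat : (fatClosures M 5 G 2).card ≤ 2)
    (hsp : ∀ B ∈ thinMembers M 5 G, 2 < (G \ clF M B).card → 7 ≤ (G \ clF M B).card)
    {B : Finset α} (hB : B ∈ thinMembers M 5 G) (hbig : 5 ≤ (B \ coloops M G).card) {z : α}
    (hz : z ∈ G \ clF M B) (hl0 : loss M 5 G B z ≠ 0) :
    L1 M 5 G (insert z B) ≤ 77 / 108 ∧
      ∃ u ∈ insert z B, ∃ u' ∈ insert z B, u ≠ u' ∧
        (insert z B).erase u ∈ thinMembers M 5 G ∧ clF M ((insert z B).erase u) = clF M B₀ ∧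
        (insert z B).erase u' ∈ thinMembers M 5 G ∧ clF M ((insert z B).erase u') = clF M B₁ := by
  have hd' : (gr M \ G).card ≤ 5 := by omega
  have hGg : G ⊆ gr M := (mem_flatsQ.1 hG).1
  have hB' : B ∈ membersIn M (Uq M (5 + 2) 5) G := (mem_thinMembers.1 hB).1
  have hBU : B ∈ Uq M (5 + 2) 5 := (mem_membersIn.1 hB').1
  have hBG : B ⊆ G := (subset_clF hBU).trans (mem_membersIn.1 hB').2
  have hKB : coloops M G ⊆ B := coloops_subset_of_mem_thinMembers hG hd' hB
  have hzB : z ∉ B := notMem_of_notMem_clF hBU (Finset.mem_sdiff.1 hz).2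
  have hzK : z ∉ coloops M G := fun h => hzB (hKB h)
  set Q := insert z B with hQ
  have hQG : Q ⊆ G := Finset.insert_subset (Finset.mem_sdiff.1 hz).1 hBG
  have hQ6 : rkN M Q = 6 := rkN_insert_eq_six_of_thin hG hB hz
  have hQK5 : rkN M (Q \ coloops M G) = 5 := rkN_insert_sdiff_coloops_eq_five_of_thin hG hd hk hB hz
  have hQKcard : 6 ≤ (Q \ coloops M G).card := by
    have h1 : Q \ coloops M G = insert z (B \ coloops M G) := by
      rw [hQ, Finset.insert_sdiff_of_notMem _ hzK]
    rw [h1, Finset.card_insert_of_notMem (fun h => hzB (Finset.mem_sdiff.1 h).1)]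
    omega
  -- the covering set is saturated
  have hsat : capS M 5 G Q < L1 M 5 G Q := by
    by_contra h
    push Not at h
    apply hl0
    unfold loss fS
    rw [if_pos h]
    ring
  have hcap := capS_ge_eleven_eighteenths_two_one hd hk hQG
  -- the thin covering preimages: faces at the (at most three) coloops of `Q ∖ K`
  set Pre := (coverPreimages M (Uq M (5 + 2) 5) G Q).filter (fun B => B ∉ lay0 M 5 G) with hPre
  have hthin : ∀ F ∈ Pre, F ∈ thinMembers M 5 G := by
    intro F hF
    rw [hPre, Finset.mem_filter, mem_coverPreimages] at hF
    exact mem_thinMembers.2 ⟨hF.1.1, hF.2⟩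
  have hface : ∀ F ∈ Pre, ∃ w ∈ Q \ coloops M G, Q.erase w = F := by
    intro F hF
    have h1 := thin_coverPreimages_subset_image_coloops hG hd' Q hF
    obtain ⟨w, hw, rfl⟩ := Finset.mem_image.1 h1
    exact ⟨w, (mem_coloops.1 hw).1, rfl⟩
  have hPre3 : Pre.card ≤ 3 := by
    refine (Finset.card_le_card (thin_coverPreimages_subset_image_coloops hG hd' Q)).trans
      (Finset.card_image_le.trans ?_)
    exact card_coloops_le_three hs hl (Finset.sdiff_subset.trans (hQG.trans hGg)) hQK5 hQKcard
  -- the fat faces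
  set Fat := Pre.filter (fun F => (G \ clF M F).card ≤ 2) with hFat
  have hFatsub : Fat ⊆ Pre := Finset.filter_subset _ _
  have hreqFat : ∀ F ∈ Fat, req M 5 F ≤ 7 / 24 := fun F hF =>
    req_le_of_thin_two_one hG hd (hthin F (hFatsub hF))
  have hreqNF : ∀ F ∈ Pre.filter (fun F => ¬ (G \ clF M F).card ≤ 2), req M 5 F ≤ 7 / 54 := by
    intro F hF
    rw [Finset.mem_filter] at hF
    rcases req_cases_of_thin_sp hG hd hsp (hthin F hF.1) with h | h
    · exact absurd h.1.le hF.2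
    · exact h.2
  have hL1 : L1 M 5 G Q ≤ (Fat.card : ℚ) * (7 / 24) + ((Pre.filter (fun F => ¬ (G \ clF M F).card ≤ 2)).card : ℚ) * (7 / 54) := by
    unfold L1
    rw [← hPre, ← Finset.sum_filter_add_sum_filter_not Pre (fun F => (G \ clF M F).card ≤ 2), ← hFat]
    have h1 : ∑ F ∈ Fat, req M 5 F ≤ (Fat.card : ℚ) * (7 / 24) := by
      calc ∑ F ∈ Fat, req M 5 F ≤ ∑ _F ∈ Fat, (7 / 24 : ℚ) := Finset.sum_le_sum hreqFat
        _ = (Fat.card : ℚ) * (7 / 24) := by rw [Finset.sum_const, nsmul_eq_mul]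
    have h2 : ∑ F ∈ Pre.filter (fun F => ¬ (G \ clF M F).card ≤ 2), req M 5 F ≤
        ((Pre.filter (fun F => ¬ (G \ clF M F).card ≤ 2)).card : ℚ) * (7 / 54) := by
      calc ∑ F ∈ Pre.filter (fun F => ¬ (G \ clF M F).card ≤ 2), req M 5 F
          ≤ ∑ _F ∈ Pre.filter (fun F => ¬ (G \ clF M F).card ≤ 2), (7 / 54 : ℚ) := Finset.sum_le_sum hreqNF
        _ = _ := by rw [Finset.sum_const, nsmul_eq_mul]
    linarith
  have hsplit : Fat.card + (Pre.filter (fun F => ¬ (G \ clF M F).card ≤ 2)).card = Pre.card := by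
    rw [hFat]; exact Finset.card_filter_add_card_filter_not _
  -- two fat faces with the same closure put `Q` inside it
  have hinj : ∀ F₁ ∈ Fat, ∀ F₂ ∈ Fat, clF M F₁ = clF M F₂ → F₁ = F₂ := by
    intro F₁ hF₁ F₂ hF₂ hcl
    by_contra hne12
    obtain ⟨w₁, hw₁, rfl⟩ := hface F₁ (hFatsub hF₁)
    obtain ⟨w₂, hw₂, rfl⟩ := hface F₂ (hFatsub hF₂)
    have hw12 : w₁ ≠ w₂ := fun h => hne12 (by rw [h])
    have hF₁U : Q.erase w₁ ∈ Uq M (5 + 2) 5 :=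
      (mem_membersIn.1 (mem_thinMembers.1 (hthin _ (hFatsub hF₁))).1).1
    have hF₂U : Q.erase w₂ ∈ Uq M (5 + 2) 5 :=
      (mem_membersIn.1 (mem_thinMembers.1 (hthin _ (hFatsub hF₂))).1).1
    have hQsub : Q ⊆ clF M (Q.erase w₁) := by
      intro x hx
      by_cases hxw : x = w₁
      · rw [hcl]
        apply subset_clF hF₂U
        exact Finset.mem_erase.2 ⟨hxw ▸ hw12, hx⟩
      · exact subset_clF hF₁U (Finset.mem_erase.2 ⟨hxw, hx⟩)
    have h1 := rkN_mono (M := M) hQsub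
    rw [hQ6, rkN_clF_eq_five_of_mem_Uq hF₁U] at h1
    omega
  have hFat2 : Fat.card ≤ 2 := by
    have hmap : ∀ F ∈ Fat, clF M F ∈ ({clF M B₀, clF M B₁} : Finset (Finset α)) := by
      intro F hF
      rw [Finset.mem_insert, Finset.mem_singleton]
      exact clF_eq_or_eq_of_fat hB₀ hB₁ hm₀ hm₁ hne hfat (hthin F (hFatsub hF))
        (Finset.mem_filter.1 hF).2
    have := Finset.card_le_card_of_injOn (clF M) (fun F hF => hmap F hF) (fun F₁ hF₁ F₂ hF₂ h => hinj F₁ hF₁ F₂ hF₂ h)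
    have h2 : ({clF M B₀, clF M B₁} : Finset (Finset α)).card ≤ 2 := Finset.card_le_two
    omega
  -- at least two fat faces
  have hg : ((Pre.filter (fun F => ¬ (G \ clF M F).card ≤ 2)).card : ℚ) ≤ 3 - (Fat.card : ℚ) := by
    have : (Pre.filter (fun F => ¬ (G \ clF M F).card ≤ 2)).card + Fat.card ≤ 3 := by omega
    have h' : (((Pre.filter (fun F => ¬ (G \ clF M F).card ≤ 2)).card + Fat.card : ℕ) : ℚ) ≤ 3 := by
      exact_mod_cast this
    push_cast at h'
    linarith
  have hFat2' : 2 ≤ Fat.card := by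
    by_contra hlt
    push Not at hlt
    have hc1 : (Fat.card : ℚ) ≤ 1 := by exact_mod_cast (by omega : Fat.card ≤ 1)
    nlinarith
  have hFatEq : Fat.card = 2 := le_antisymm hFat2 hFat2'
  refine ⟨?_, ?_⟩
  · have hc2 : ((Pre.filter (fun F => ¬ (G \ clF M F).card ≤ 2)).card : ℚ) ≤ 1 := by
      exact_mod_cast (by omega : (Pre.filter (fun F => ¬ (G \ clF M F).card ≤ 2)).card ≤ 1)
    have hc1 : (Fat.card : ℚ) = 2 := by exact_mod_cast hFatEq
    nlinarith
  · obtain ⟨F₁, hF₁, F₂, hF₂, hne12⟩ := Finset.one_lt_card.1 (by omega : 1 < Fat.card)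
    obtain ⟨w₁, hw₁, hF₁eq⟩ := hface F₁ (hFatsub hF₁)
    obtain ⟨w₂, hw₂, hF₂eq⟩ := hface F₂ (hFatsub hF₂)
    have hw12 : w₁ ≠ w₂ := fun h => hne12 (by rw [← hF₁eq, ← hF₂eq, h])
    have hcl1 := clF_eq_or_eq_of_fat hB₀ hB₁ hm₀ hm₁ hne hfat (hthin F₁ (hFatsub hF₁))
      (Finset.mem_filter.1 hF₁).2
    have hcl2 := clF_eq_or_eq_of_fat hB₀ hB₁ hm₀ hm₁ hne hfat (hthin F₂ (hFatsub hF₂))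
      (Finset.mem_filter.1 hF₂).2
    have hclne : clF M F₁ ≠ clF M F₂ := fun h => hne12 (hinj F₁ hF₁ F₂ hF₂ h)
    have hw₁Q : w₁ ∈ Q := (Finset.mem_sdiff.1 hw₁).1
    have hw₂Q : w₂ ∈ Q := (Finset.mem_sdiff.1 hw₂).1
    rcases hcl1 with h1 | h1 <;> rcases hcl2 with h2 | h2
    · exact absurd (h1.trans h2.symm) hclne
    · exact ⟨w₁, hw₁Q, w₂, hw₂Q, hw12, hF₁eq ▸ hthin F₁ (hFatsub hF₁), hF₁eq ▸ h1,
        hF₂eq ▸ hthin F₂ (hFatsub hF₂), hF₂eq ▸ h2⟩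
    · exact ⟨w₂, hw₂Q, w₁, hw₁Q, hw12.symm, hF₂eq ▸ hthin F₂ (hFatsub hF₂), hF₂eq ▸ h2,
        hF₁eq ▸ hthin F₁ (hFatsub hF₁), hF₁eq ▸ h1⟩
    · exact absurd (h1.trans h2.symm) hclne

open scoped Classical in
/-- **THE BIG-FACE LOSSES OF ANY SET SUM TO AT MOST `11/108`** (cell `(2, 1)`, spread regime, two fat closures):
a set with a lossy big face is a lossy big covering set, whose excess `L1 − capS` is at most `77/108 − 11/18`. -/
theorem faceLossP_sum_le_two_one (hG : G ∈ flatsQ M (5 + 1)) (hd : (gr M \ G).card = 2)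
    (hk : kColoops M G = 1) (hs : ∀ e ∈ gr M, ∀ f ∈ gr M, e ≠ f → rkN M {e, f} = 2)
    (hl : ∀ e ∈ gr M, M.Indep {e}) {B₀ B₁ : Finset α} (hB₀ : B₀ ∈ thinMembers M 5 G)
    (hB₁ : B₁ ∈ thinMembers M 5 G) (hm₀ : (G \ clF M B₀).card ≤ 2) (hm₁ : (G \ clF M B₁).card ≤ 2)
    (hne : clF M B₀ ≠ clF M B₁) (hfat : (fatClosures M 5 G 2).card ≤ 2)
    (hsp : ∀ B ∈ thinMembers M 5 G, 2 < (G \ clF M B).card → 7 ≤ (G \ clF M B).card) (Q : Finset α) :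
    ∑ w ∈ Q, faceLossP M 5 G (fun B => 5 ≤ (B \ coloops M G).card) Q w ≤ 11 / 108 := by
  have hd' : (gr M \ G).card ≤ 5 := by omega
  by_cases hex : ∃ w ∈ Q, faceLossP M 5 G (fun B => 5 ≤ (B \ coloops M G).card) Q w ≠ 0
  · obtain ⟨w₀, hw₀, hne0⟩ := hex
    have hcond : Q.erase w₀ ∈ thinMembers M 5 G ∧ 5 ≤ (Q.erase w₀ \ coloops M G).card ∧
        w₀ ∈ G \ clF M (Q.erase w₀) := by
      unfold faceLossP at hne0
      by_contra h
      rw [if_neg h] at hne0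
      exact hne0 rfl
    have hloss : loss M 5 G (Q.erase w₀) w₀ ≠ 0 := by
      unfold faceLossP at hne0
      rwa [if_pos hcond] at hne0
    have hQeq : insert w₀ (Q.erase w₀) = Q := Finset.insert_erase hw₀
    have h1 := two_fat_faces_of_loss_ne_zero hG hd hk hs hl hB₀ hB₁ hm₀ hm₁ hne hfat hsp hcond.1 hcond.2.1
      hcond.2.2 hloss
    rw [hQeq] at h1
    have hL1 := h1.1
    have hQG : Q ⊆ G := by
      rw [← hQeq]
      exact Finset.insert_subset (Finset.mem_sdiff.1 hcond.2.2).1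
        ((subset_clF (mem_membersIn.1 (mem_thinMembers.1 hcond.1).1).1).trans
          (mem_membersIn.1 (mem_thinMembers.1 hcond.1).1).2)
    have hcap := capS_ge_eleven_eighteenths_two_one hd hk hQG
    have hsat : capS M 5 G Q < L1 M 5 G Q := by
      by_contra h
      push Not at h
      apply hloss
      unfold loss fS
      rw [hQeq, if_pos h]
      ring
    -- the `P`-face losses vanish at the coloops and are bounded by the face losses elsewhere
    have hzeroK : ∀ w ∈ Q, w ∈ coloops M G →
        faceLossP M 5 G (fun B => 5 ≤ (B \ coloops M G).card) Q w = 0 := by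
      intro w _ hwK
      unfold faceLossP
      rw [if_neg]
      rintro ⟨hthin, -, -⟩
      have := coloops_subset_of_mem_thinMembers hG hd' hthin hwK
      exact (Finset.notMem_erase w Q) this
    have hsum : ∑ w ∈ Q, faceLossP M 5 G (fun B => 5 ≤ (B \ coloops M G).card) Q w =
        ∑ w ∈ Q \ coloops M G, faceLossP M 5 G (fun B => 5 ≤ (B \ coloops M G).card) Q w := by
      symm
      apply Finset.sum_subset Finset.sdiff_subset
      intro w hw hwn
      have hwK : w ∈ coloops M G := by
        by_contra h
        exact hwn (Finset.mem_sdiff.2 ⟨hw, h⟩)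
      exact hzeroK w hw hwK
    have hle := Finset.sum_le_sum (fun w (_ : w ∈ Q \ coloops M G) =>
      faceLossP_le_faceLoss (P := fun B => 5 ≤ (B \ coloops M G).card) hG hd' Q w)
    have hL := sum_faceLoss_le_L1_mul hG hd' Q
    have hfS : fS M 5 G Q = capS M 5 G Q / L1 M 5 G Q := by
      unfold fS
      rw [if_neg (not_le.2 hsat)]
    have hL1pos : 0 < L1 M 5 G Q := by linarith
    have hexc : L1 M 5 G Q * (1 - fS M 5 G Q) = L1 M 5 G Q - capS M 5 G Q := by
      rw [hfS]; field_simp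
    rw [hsum]
    linarith
  · push Not at hex
    rw [Finset.sum_eq_zero hex]
    norm_num

end FatFaces

end PercRepro.Shadow
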